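import Summits.HubbardSuperconductivity.HubbardSuperconductivity.Theorems.ParityGapRigidityIncommensurateRigidityEtsBridgeRefined
import HarnessLib

/-!
# Route ParityGapRigidity — crux `IncommensurateRigidity` (stmt-HubbardSuperconductivity-2195):
# the finite-range reading of (H2) makes the crux at irrational `δ` a corollary of `EtsTrichotomy`

Helper file (`--supports stmt-HubbardSuperconductivity-2195`, line `registered`, lead c9), sequel of
`…EtsBridge` (p167164), `…StructureFactor` (p167919), `…EtsBridgeRefined` (p168125).

The crux's (H2) is advertised as "no charge/spin/bond/current density-wave order at any wavevector"
but, as typed, it constrains only one-body operators supported on pairs at torus distance `≤ 1`.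
This file records the natural finite-range reading — for every range `r`, normal fluctuations
`Re⟨A†A⟩_ψ − |⟨A⟩_ψ|² ≤ C_r·L²` of every one-body `A = Σ_p a(p) c†_{p₁}c_{p₂}`, `|a| ≤ 1`, supported on
pairs at torus distance `≤ r` — and proves that with it NOTHING ELSE is needed: `EtsTrichotomy`
(stmt-1458) + `U > 0` + irrational `δ` + (H1) verbatim + finite-range (H2) ⟹ the crux's conclusion at
`(U, δ)` (`yangODLRO_of_etsTrichotomy_of_finiteRangeFluctuations`, registered sub-goal). Ingredients:
the structure-factor bound of `…StructureFactor` at range `r` (`structureFactor_le_of_normalFluctuationsAt_range`,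
same Fourier-decomposition proof) and the coefficient-function lemmas of `…EtsBridgeRefined`.
(H3), (H4) remain idle. No definitions; nothing vendored; folklore.
-/

noncomputable section

namespace Summit.HubbardSuperconductivity.IncommensurateRigidity.Birth

open scoped BigOperators Matrix ComplexConjugate
open Matrix Filter Topology Literature.MathematicalPhysics.QuantumLattice Literature.Probability.LatticeModels

section Range

variable {L : ℕ} [NeZero L]

/-- **Range-`r` structure factors from range-`r` normal fluctuations** (the proof of
`structureFactor_le_of_normalFluctuationsAt` with `1` replaced by `r`): a variance bound `≤ C` over all
normalised sector ground states for all `O_b`, `|b| ≤ 1`, range `≤ r`, gives `Re⟨O_a† O_a⟩_ψ ≤ C·A²` for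
every coefficient function `a` of nonzero momentum, `|a| ≤ A`, range `≤ r`. [folklore] -/
theorem structureFactor_le_of_normalFluctuationsAt_range (r : ℕ) (t U : ℝ) (N : ℕ) (M : ℝ) {C : ℝ}
    (hH2 : ∀ φ, IsGroundStateInSector (hubbardTorus 2 L t U) N M φ → star φ ⬝ᵥ φ = 1 →
      ∀ b : Orb (FermionTorus 2 L) × Orb (FermionTorus 2 L) → ℂ, (∀ p, ‖b p‖ ≤ 1) →
        (∀ p, b p ≠ 0 → torusDist (ofLex p.1).1.toTorusSite (ofLex p.2).1.toTorusSite ≤ r) →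
        (expect (Matrix.conjTranspose (∑ p, b p • (creation p.1 * annihilation p.2)) *
            (∑ p, b p • (creation p.1 * annihilation p.2))) φ).re -
          ‖expect (∑ p, b p • (creation p.1 * annihilation p.2)) φ‖ ^ 2 ≤ C)
    (a : Orb (FermionTorus 2 L) × Orb (FermionTorus 2 L) → ℂ) {A : ℝ} (hA : 0 < A)
    (ha : ∀ p, ‖a p‖ ≤ A)
    (hsupp : ∀ p, a p ≠ 0 → torusDist (ofLex p.1).1.toTorusSite (ofLex p.2).1.toTorusSite ≤ r)
    {q : TorusSite 2 L} (hq : q ≠ 0)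
    (hcov : ∀ (v : TorusSite 2 L) (p : Orb (FermionTorus 2 L) × Orb (FermionTorus 2 L)),
      a (Orb.translate v p.1, Orb.translate v p.2) = torusChar q v * a p)
    (ψ : Fock (Orb (FermionTorus 2 L))) (hψ : IsGroundStateInSector (hubbardTorus 2 L t U) N M ψ)
    (hn : star ψ ⬝ᵥ ψ = 1) :
    (expect (Matrix.conjTranspose (∑ p, a p • (creation p.1 * annihilation p.2)) *
        (∑ p, a p • (creation p.1 * annihilation p.2))) ψ).re ≤ C * A ^ 2 := by
  set c : ℂ := ((A⁻¹ : ℝ) : ℂ) with hc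
  set b : Orb (FermionTorus 2 L) × Orb (FermionTorus 2 L) → ℂ := fun p => c * a p with hb
  have hb1 : ∀ p, ‖b p‖ ≤ 1 := fun p => by
    simp only [hb, hc, norm_mul, Complex.norm_real, Real.norm_eq_abs, abs_of_pos (inv_pos.2 hA)]
    calc A⁻¹ * ‖a p‖ ≤ A⁻¹ * A := by gcongr; exact ha p
      _ = 1 := inv_mul_cancel₀ hA.ne'
  have hbsupp : ∀ p, b p ≠ 0 →
      torusDist (ofLex p.1).1.toTorusSite (ofLex p.2).1.toTorusSite ≤ r := fun p hp =>
    hsupp p fun h => hp (by simp only [hb, h, mul_zero])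
  have hbcov : ∀ (v : TorusSite 2 L) (p : Orb (FermionTorus 2 L) × Orb (FermionTorus 2 L)),
      b (Orb.translate v p.1, Orb.translate v p.2) = torusChar q v * b p := fun v p => by
    simp only [hb]
    rw [hcov]
    ring
  have hO : (∑ p, b p • (creation p.1 * annihilation p.2)) =
      c • ∑ p : Orb (FermionTorus 2 L) × Orb (FermionTorus 2 L), a p • (creation p.1 * annihilation p.2) := by
    rw [Finset.smul_sum]
    simp_rw [hb, mul_smul]
  have hmain := re_expect_conjTranspose_mul_self_le_of_translation t U N M _ hq
    (fockTranslate_mul_oneBody_of_covariant b q hbcov) (fun φ hφ hφn => hH2 φ hφ hφn b hb1 hbsupp) ψ hψ hn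
  rw [hO, conjTranspose_smul, smul_mul_assoc, mul_smul_comm, smul_smul, expect_smul] at hmain
  have hcc : star c * c = (((A⁻¹) ^ 2 : ℝ) : ℂ) := by
    rw [hc, Complex.star_def, Complex.conj_ofReal]
    push_cast
    ring
  rw [hcc, Complex.re_ofReal_mul] at hmain
  have hA2 : 0 < A ^ 2 := by positivity
  calc (expect (Matrix.conjTranspose (∑ p, a p • (creation p.1 * annihilation p.2)) *
          (∑ p, a p • (creation p.1 * annihilation p.2))) ψ).re
      = A ^ 2 * (A⁻¹ ^ 2 * (expect (Matrix.conjTranspose (∑ p, a p • (creation p.1 * annihilation p.2)) *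
          (∑ p, a p • (creation p.1 * annihilation p.2))) ψ).re) := by
        rw [← mul_assoc, ← mul_pow, mul_inv_cancel₀ hA.ne', one_pow, one_mul]
    _ ≤ A ^ 2 * C := mul_le_mul_of_nonneg_left hmain hA2.le
    _ = C * A ^ 2 := mul_comm _ _

/-- A step `e ∈ ℤ²` with `|e_i| ≤ r` projects to a torus vector of periodic norm `≤ r`. [folklore] -/
theorem torusNorm_proj_le_of_abs_le {e : Site 2} {r : ℕ} (he : ∀ i, |e i| ≤ r) :
    torusNorm (Torus.proj L e) ≤ r := by
  refine Finset.sup_le fun i _ => ?_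
  rw [← ZMod.valMinAbs_natAbs_eq_min, Torus.proj_apply]
  have h1 : ((e i : ℤ) : ZMod L).valMinAbs.natAbs ≤ (e i).natAbs :=
    ZMod.natAbs_min_of_le_div_two L _ _ (by rw [ZMod.coe_valMinAbs]) (ZMod.natAbs_valMinAbs_le _)
  have h2 : (e i).natAbs ≤ r := by
    have := he i
    rw [Int.abs_eq_natAbs] at this
    exact_mod_cast this
  exact h1.trans h2

/-- Every step of a finite set `R ⊂ ℤ²` has coordinates bounded by `max_{e ∈ R} max_i |e_i|`. [folklore] -/
theorem abs_le_sup_of_mem {R : Finset (Site 2)} {e : Site 2} (he : e ∈ R) (i : Fin 2) :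
    |e i| ≤ ((R.sup fun e => Finset.univ.sup fun i => (e i).natAbs : ℕ) : ℤ) := by
  rw [Int.abs_eq_natAbs]
  exact_mod_cast (Finset.le_sup (f := fun i => (e i).natAbs) (Finset.mem_univ i)).trans
    (Finset.le_sup (f := fun e => Finset.univ.sup fun i => (e i).natAbs) he)

end Range

/-- **The finite-range bridge.** `EtsTrichotomy` (stmt-1458, a HYPOTHESIS) + `U > 0` + `δ ∈ (0,1/2)`
irrational + the crux's (H1) verbatim + the FINITE-RANGE reading of (H2) (for every range `r : ℕ`
there are `C, L₀` with `Re⟨A†A⟩_ψ − |⟨A⟩_ψ|² ≤ C·L²` for every one-body `A = Σ_p a(p) c†_{p₁}c_{p₂}`,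
`|a| ≤ 1`, supported on pairs at torus distance `≤ r`, every normalised `(N_L,0)`-sector ground state
`ψ`, every even `L ≥ L₀`) ⟹ the crux's conclusion at `(U, δ)` verbatim. Proof: for branch (B)'s
`(R, a)` take `r = max_{e∈R} |e|_∞`; the density-wave operator is the one-body operator of its
coefficient function (momentum `q`, modulus `≤ Σ|a|`, range `≤ r`), so
`structureFactor_le_of_normalFluctuationsAt_range` bounds its second moment by `C L² A² ≤ c L⁴`
eventually; then `yangODLRO_of_etsTrichotomy`. [folklore] -/
theorem yangODLRO_of_etsTrichotomy_of_finiteRangeFluctuations :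
    Summit.HubbardSuperconductivity.HubbardSuperconductivity.Theses.AnomalyExhaustion.EtsTrichotomy →
    ∀ (U δ : ℝ), 0 < U → δ ∈ Set.Ioo (0 : ℝ) (1 / 2) → Irrational δ →
    (∃ C m : ℝ, 0 < m ∧ ∃ L₀ : ℕ, ∀ L ≥ L₀, Even L → ∀ Hm, Hm = hubbardTorus 2 L 1 U → ∀ ψ,
      IsGroundStateInSector Hm (2 * ⌊(1 - δ) * (L : ℝ) ^ 2 / 2⌋₊) 0 ψ → star ψ ⬝ᵥ ψ = 1 →
      ∀ (x y : FermionTorus 2 L) (σ τ : Fin 2),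
        ‖oneParticleRDM ψ (orb x σ) (orb y τ)‖ ≤
          C * Real.exp (-(m * (torusDist x.toTorusSite y.toTorusSite : ℝ)))) →
    (∀ r : ℕ, ∃ C : ℝ, ∃ L₀ : ℕ, ∀ L ≥ L₀, Even L → ∀ Hm, Hm = hubbardTorus 2 L 1 U → ∀ ψ,
      IsGroundStateInSector Hm (2 * ⌊(1 - δ) * (L : ℝ) ^ 2 / 2⌋₊) 0 ψ → star ψ ⬝ᵥ ψ = 1 →
      ∀ a : Orb (FermionTorus 2 L) × Orb (FermionTorus 2 L) → ℂ, (∀ p, ‖a p‖ ≤ 1) →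
        (∀ p, a p ≠ 0 → torusDist (ofLex p.1).1.toTorusSite (ofLex p.2).1.toTorusSite ≤ r) →
        (expect (Matrix.conjTranspose (∑ p, a p • (creation p.1 * annihilation p.2)) *
            (∑ p, a p • (creation p.1 * annihilation p.2))) ψ).re -
          ‖expect (∑ p, a p • (creation p.1 * annihilation p.2)) ψ‖ ^ 2 ≤ C * (L : ℝ) ^ 2) →
    ∃ a : ℝ, 0 < a ∧ ∃ L₁ : ℕ, ∀ L ≥ L₁, Even L → ∀ Hm, Hm = hubbardTorus 2 L 1 U → ∀ ψ,
      IsGroundStateInSector Hm (2 * ⌊(1 - δ) * (L : ℝ) ^ 2 / 2⌋₊) 0 ψ → star ψ ⬝ᵥ ψ = 1 →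
      ∃ v : Orb (FermionTorus 2 L) × Orb (FermionTorus 2 L) → ℂ,
        star v ⬝ᵥ v = 1 ∧ a * (L : ℝ) ^ 2 ≤ (star v ⬝ᵥ Matrix.mulVec (twoParticleRDM ψ) v).re := by
  intro hE U δ hU hδ hirr h1 h2
  refine yangODLRO_of_etsTrichotomy hE U δ hU hδ hirr h1 fun R a c hc => ?_
  -- the range of `R`
  set r : ℕ := R.sup fun e => Finset.univ.sup fun i => (e i).natAbs with hr
  obtain ⟨C, L₂, hC⟩ := h2 r
  set A : ℝ := ∑ e ∈ R, ∑ σ : Fin 2, ∑ τ : Fin 2, ‖a e σ τ‖ + 1 with hAdef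
  have hA : 0 < A := by positivity
  set C' : ℝ := max C 0 with hC'
  obtain ⟨L₄, hL₄⟩ := exists_nat_ge (C' * A ^ 2 / c)
  refine ⟨max L₂ (max L₄ 1), fun L _ hL hev ψ hgs hn q hq => ?_⟩
  have hL2 : L₂ ≤ L := le_trans (le_max_left _ _) hL
  have hL4 : (L₄ : ℝ) ≤ L := by exact_mod_cast le_trans (le_max_left _ _) (le_trans (le_max_right _ _) hL)
  have hL1 : (1 : ℝ) ≤ L := by exact_mod_cast le_trans (le_max_right _ _) (le_trans (le_max_right _ _) hL)
  have hmain := structureFactor_le_of_normalFluctuationsAt_range r 1 U _ 0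
    (fun φ hφ hφn b hb1 hbs => hC L hL2 hev _ rfl φ hφ hφn b hb1 hbs) _ hA
    (fun p => (norm_coef_le R a q p).trans (le_add_of_nonneg_right zero_le_one))
    (fun p hp => torusDist_le_of_coef_ne_zero R a q
      (fun e he σ τ _ => torusNorm_proj_le_of_abs_le (abs_le_sup_of_mem he)) p hp)
    hq (fun v p => coef_translate R a q v p) ψ hgs hn
  rw [sum_coef_smul_eq_densityWave] at hmain
  -- `C L² A² ≤ C' L² A² ≤ c L⁴`
  have hkey : C' * (L : ℝ) ^ 2 * A ^ 2 ≤ c * (L : ℝ) ^ 4 := by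
    have h1 : C' * A ^ 2 / c ≤ L := hL₄.trans hL4
    rw [div_le_iff₀ hc] at h1
    have hLL : (L : ℝ) ≤ (L : ℝ) ^ 2 := by
      rw [sq]
      exact le_mul_of_one_le_right (by linarith) hL1
    have h2 : C' * A ^ 2 ≤ c * (L : ℝ) ^ 2 :=
      h1.trans (by rw [mul_comm]; exact mul_le_mul_of_nonneg_left hLL hc.le)
    have h3 : C' * A ^ 2 * (L : ℝ) ^ 2 ≤ c * (L : ℝ) ^ 2 * (L : ℝ) ^ 2 :=
      mul_le_mul_of_nonneg_right h2 (sq_nonneg _)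
    nlinarith [h3]
  have hC'C : C * (L : ℝ) ^ 2 * A ^ 2 ≤ C' * (L : ℝ) ^ 2 * A ^ 2 := by
    gcongr
    exact le_max_left _ _
  linarith

end Summit.HubbardSuperconductivity.IncommensurateRigidity.Birth

end
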